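import Summits.CriticalPhenomena.PercolationContinuityZ3.Theorems.PercNearOneGluingNoHeavyConstsMDLXJointXEdgeInduction
import Summits.CriticalPhenomena.PercolationContinuityZ3.Theorems.PercNearOneGluingNoHeavyConstsMDLXJointMarkerLattice
import HarnessLib

/-!
# CROSS at the reach marker `u = z` on the reach-pinned classes (PAPER-2 track (ii), seat `prim-consts-2`, gen 20)

builds on p205010 (kernel theorem, internal audit signed; external expert review pending).  Support file (`--supports
stmt-CriticalPhenomena-4575`); theorems only, no sorries, standard axioms.  Memos `run/shared/lean/prim/consts/FROM-prim-consts-2-g18-XEDGE-CROSS.md` §0(4e),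
`…-g19-RIDER-EXCHANGE.md` §0(3d), §5, `…-g20-AVOID-SPLIT.md`.

`Consts.CrossRel` (…`XEdgeInduction.lean`) asks, for nested avoided sets `X ⊂ X' = X ∪ {u}`, that the two CROSS members
`M₁ = P(X',X,X)+P(X,X',X)+P(X,X,X')` and `M₂ = P(X',X',X)+P(X',X,X')+P(X,X',X')` of the polarised MDL(X)′ margin `P = Consts.polMargin` be `≥ 0`;
`Consts.mdlxJoint_of_crossRel` turns it into `Consts.MDLXJoint`, and `Consts.crossRel_marker` settles `u = y`.  THIS FILE: the added vertex is the
REACH marker, `u = z`.  Then every `X'`-slot kills `{s ↔ z}` and `{y ↔ z}` (`T(X') ∩ W = ∅`, `D(X') ∩ Z = ∅`), and with `D' = D ∩ {s ↮ z}`,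
`T' = T(X∪{z})`:  `M₂ = μ(T')·cov_D(F;Z) − μ(T∩W)·cov_{D'}(F;Y)` ("R2z"), `M₁ = μ(T')·cov_D(F;Z) + [t-terms] …` (gen 18 (4e)).
* `Consts.polMargin_sub_const` — the polarised margin is invariant under `F ↦ F − c`.
* `Consts.crossRel_reach_of_eq_off_reach` — **THEOREM: both members are `≥ 0` at `u = z` for every monotone `F` supported on `{z ∈ V(C_s)}`**
  (`F(C) = F(∅)` unless a pair of `C` contains `z`; all up-events `U ⊆ {s↔z}`): after the shift `F ← F − F(∅)`, `F` vanishes on `D'`, so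
  `M₂ = μ(T')μ(D')∫_D F ≥ 0` and `M₁ ≥ μ(D')(μ(T)∫_D F − μ(T∩W)∫_{D∩Y}F) ≥ 0`.
* `Consts.crossRel_reach_of_eq_on_reach` — **both members are `≥ 0` at `u = z` for every monotone `F` constant on `{z ∈ V(C_s)}`** (all up-events
  `U ⊇ {s↔z}`), GIVEN the cross-conditioning exchange (F1) `μ(T∩W)·μ(D'∩Y) ≤ μ(T')·μ(D∩Z)` as a hypothesis (it is `Consts.crossExchange_F1` of the
  pending file `…ConstsCrossExchange.lean`, seat gen 19, an instance of `Consts.localEv_fourEvents`); with `H = M − F ≥ 0` antitone and vanishing on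
  `{s↔z}`: `M₂ = ∫_D H·μ(T')μ(D∩Z) + μ(T∩W)·cov_{D'}(H;Y) ≥ (∫_D H)(μ(T')μ(D∩Z) − μ(T∩W)μ(D'∩Y))`, and `M₁` similarly with `Consts.mdlx_marker_reach_le`.
The remaining pinned class `U ⊆ {s↔y}` (five-term exchange identity, g19 §0(3d)) and the generic class are not treated here.  Numerics (this seat gen 20,
kit j201889/j201891): `M₁, M₂ ≥ 0` in 615 993 random corner-weight instances `n ≤ 7`, `m ≤ 11` (30 % with `u = z`), 0 violations.
[cite: VandenbergHaggstromKahn2005, Thm. 1.1 (pp. 3–5), Thm. 1.3 (p. 6), §2.1 (pp. 9–13)]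
-/

noncomputable section

namespace Summit.CriticalPhenomena.PercolationContinuityZ3.Theorems

open MeasureTheory Set Literature.Probability.LatticeModels Literature.Probability.Percolation
open scoped Classical

namespace Consts

variable {V : Type*} [Fintype V]

/-- The polarised margin is invariant under shifting the functional by a constant (each bracket is a covariance). [folklore] -/
theorem polMargin_sub_const (w : Sym2 V → unitInterval) (s y z : V) (F : Set (Sym2 V) → ℝ) (c : ℝ) (X₀ X₁ X₂ : Set V) :
    polMargin (prodBernoulli w) s y z (fun C => F C - c) X₀ X₁ X₂ = polMargin (prodBernoulli w) s y z F X₀ X₁ X₂ := by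
  unfold polMargin
  have h : ∀ S : Set (BondConfig V), ∫ ω in S, (F (openEdgeCluster ω s) - c) ∂(prodBernoulli w) =
      (∫ ω in S, F (openEdgeCluster ω s) ∂(prodBernoulli w)) - c * (prodBernoulli w).real S := by
    intro S
    rw [integral_sub Integrable.of_finite Integrable.of_finite, setIntegral_const, smul_eq_mul, mul_comm]
  simp only [h]
  ring


omit [Fintype V] in
/-- With `u = z`: `{s ↮ X ∪ {z}} = {s ↮ X} ∖ {s ↔ z}`. [folklore] -/
theorem avoid_insert_eq_diff (s z : V) (X : Set V) :
    {ω : BondConfig V | ∀ x ∈ insert z X, ¬ (openGraph ω).Reachable s x} =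
      {ω : BondConfig V | ∀ x ∈ X, ¬ (openGraph ω).Reachable s x} \ openConn s z := by
  ext ω
  simp only [mem_setOf_eq, forall_mem_insert, mem_sdiff, openConn]
  tauto

omit [Fintype V] in
/-- With `u = z`: the copy-0 event of the `X ∪ {z}`-slot is disjoint from `{y ↔ z}`. [folklore] -/
theorem avoidY_insert_inter_conn_eq_empty (s y z : V) (X : Set V) (S : Set (BondConfig V)) :
    {ω : BondConfig V | ∀ x ∈ insert s (insert z X), ¬ (openGraph ω).Reachable y x} ∩ S ∩ openConn y z = ∅ := by
  refine Set.eq_empty_of_forall_notMem fun ω hω => ?_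
  exact hω.1.1 z (mem_insert_of_mem s (mem_insert z X)) hω.2

/-- **CROSS at `u = z`, reach-pinned class I: `F` supported on `{z ∈ V(C_s)}`.**  For monotone `F` with `F(C) = F(∅)` whenever no pair of `C`
contains `z`, both CROSS members for the nested avoided sets `X ⊂ X ∪ {z}` are nonnegative (no hypothesis on the graph; `z = s` is degenerate).
[cite: VandenbergHaggstromKahn2005, Thm. 1.3 (p. 6), §2.1 (pp. 9–13)] -/
theorem crossRel_reach_of_eq_off_reach (w : Sym2 V → unitInterval) (s y z : V) (X : Set V)
    (F : Set (Sym2 V) → ℝ) (hF : Monotone F) (hFz : ∀ C : Set (Sym2 V), (∀ e ∈ C, z ∉ e) → F C = F ∅) :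
    0 ≤ polMargin (prodBernoulli w) s y z F (insert z X) X X + polMargin (prodBernoulli w) s y z F X (insert z X) X +
        polMargin (prodBernoulli w) s y z F X X (insert z X) ∧
      0 ≤ polMargin (prodBernoulli w) s y z F (insert z X) (insert z X) X +
          polMargin (prodBernoulli w) s y z F (insert z X) X (insert z X) +
        polMargin (prodBernoulli w) s y z F X (insert z X) (insert z X) := by
  classical
  set μ := prodBernoulli w with hμ
  -- degenerate case `z = s`
  by_cases hzs : z = s
  · subst hzs
    have h0 : ∀ X₁ X₂ : Set V, polMargin μ z y z F (insert z X) X₁ X₂ = 0 := fun X₁ X₂ =>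
      polMargin_eq_zero_of_slot0 μ z y z F _ X₁ X₂ (Or.inl (mem_insert z X))
    have h1 : ∀ X₀ X₂ : Set V, polMargin μ z y z F X₀ (insert z X) X₂ = 0 := fun X₀ X₂ =>
      polMargin_eq_zero_of_slot1 μ z y z F X₀ _ X₂ (mem_insert z X)
    have h2 : ∀ X₀ X₁ : Set V, polMargin μ z y z F X₀ X₁ (insert z X) = 0 := fun X₀ X₁ =>
      polMargin_eq_zero_of_slot2 μ z y z F X₀ X₁ _ (mem_insert z X)
    rw [h0, h1, h2, h0, h0, h1]; norm_num
  -- shift: `G = F − F(∅) ≥ 0`, vanishing off `{s ↔ z}`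
  rw [← polMargin_sub_const w s y z F (F ∅) (insert z X) X X, ← polMargin_sub_const w s y z F (F ∅) X (insert z X) X,
    ← polMargin_sub_const w s y z F (F ∅) X X (insert z X), ← polMargin_sub_const w s y z F (F ∅) (insert z X) (insert z X) X,
    ← polMargin_sub_const w s y z F (F ∅) (insert z X) X (insert z X), ← polMargin_sub_const w s y z F (F ∅) X (insert z X) (insert z X)]
  set G : Set (Sym2 V) → ℝ := fun C => F C - F ∅ with hG
  have hmeas : ∀ S : Set (BondConfig V), MeasurableSet S := fun _ => MeasurableSet.of_discrete
  set D : Set (BondConfig V) := {ω | ∀ x ∈ X, ¬ (openGraph ω).Reachable s x} with hD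
  set D' : Set (BondConfig V) := {ω | ∀ x ∈ insert z X, ¬ (openGraph ω).Reachable s x} with hD'
  set A : Set (BondConfig V) := {ω | ∀ x ∈ insert s X, ¬ (openGraph ω).Reachable y x} with hA
  set A' : Set (BondConfig V) := {ω | ∀ x ∈ insert s (insert z X), ¬ (openGraph ω).Reachable y x} with hA'
  set Yv : Set (BondConfig V) := openConn s y with hYv
  set Zv : Set (BondConfig V) := openConn s z with hZv
  set g : BondConfig V → ℝ := fun ω => G (openEdgeCluster ω s) with hg
  have hg0 : ∀ ω, 0 ≤ g ω := fun ω => sub_nonneg.2 (hF (empty_subset _))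
  have hgZ : ∀ ω, ω ∉ Zv → g ω = 0 := by
    intro ω hω
    have hno : ∀ e ∈ openEdgeCluster ω s, z ∉ e := fun e he hze =>
      hω ((reachable_iff_exists_mem_openEdgeCluster ω s z).2 (Or.inr ⟨e, he, hze⟩))
    show F (openEdgeCluster ω s) - F ∅ = 0
    rw [hFz _ hno, sub_self]
  -- set facts
  have hD'eq : D' = D \ Zv := avoid_insert_eq_diff s z X
  have hD'Z : D' ∩ Zv = ∅ := by rw [hD'eq]; exact Set.sdiff_inter_self
  have hA'W : ∀ S : Set (BondConfig V), A' ∩ S ∩ openConn y z = ∅ := avoidY_insert_inter_conn_eq_empty s y z X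
  -- base quantities
  set t := μ.real (A ∩ D) with ht
  set tw := μ.real (A ∩ D ∩ openConn y z) with htw
  set t' := μ.real (A' ∩ D') with ht'
  set d := μ.real D with hd
  set d' := μ.real D' with hd'
  set dz := μ.real (D ∩ Zv) with hdz
  set dy := μ.real (D ∩ Yv) with hdy
  set dy' := μ.real (D' ∩ Yv) with hdy'
  set I := ∫ ω in D, g ω ∂μ with hI
  set IY := ∫ ω in D ∩ Yv, g ω ∂μ with hIY
  have hI0 : 0 ≤ I := setIntegral_nonneg (hmeas D) fun ω _ => hg0 ω
  have hIY0 : 0 ≤ IY := setIntegral_nonneg (hmeas _) fun ω _ => hg0 ω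
  have hgi : ∀ S : Set (BondConfig V), IntegrableOn g S μ := fun S => (Integrable.of_finite (f := g)).integrableOn
  have hIYle : IY ≤ I := by
    have h := integral_inter_add_sdiff (μ := μ) (s := D) (hmeas Yv) (hgi D)
    have h2 : 0 ≤ ∫ ω in D \ Yv, g ω ∂μ := setIntegral_nonneg (hmeas _) fun ω _ => hg0 ω
    rw [← hI, ← hIY] at h; linarith
  have hIZ : ∫ ω in D ∩ Zv, g ω ∂μ = I := by
    have h := integral_inter_add_sdiff (μ := μ) (s := D) (hmeas Zv) (hgi D)
    have h2 : ∫ ω in D \ Zv, g ω ∂μ = 0 := setIntegral_eq_zero_of_forall_eq_zero fun ω hω => hgZ ω hω.2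
    rw [← hI] at h; linarith
  -- the primed integrals vanish (`D' ⊆ Zᶜ`)
  have hgD' : ∀ S : Set (BondConfig V), ∫ ω in D' ∩ S, g ω ∂μ = 0 := fun S =>
    setIntegral_eq_zero_of_forall_eq_zero fun ω hω => hgZ ω (by rw [hD'eq] at hω; exact hω.1.2)
  have hgD'0 : ∫ ω in D', g ω ∂μ = 0 :=
    setIntegral_eq_zero_of_forall_eq_zero fun ω hω => hgZ ω (by rw [hD'eq] at hω; exact hω.2)
  have hdz' : μ.real (D' ∩ Zv) = 0 := by rw [hD'Z, measureReal_empty]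
  have htw' : μ.real (A' ∩ D' ∩ openConn y z) = 0 := by rw [hA'W, measureReal_empty]
  have hd'eq : d' = d - dz := by
    have h := measureReal_inter_add_sdiff (μ := μ) (s := D) (hmeas Zv)
    rw [hd', hD'eq]; linarith
  -- nonnegativity of masses
  have h0 : ∀ S : Set (BondConfig V), 0 ≤ μ.real S := fun _ => measureReal_nonneg
  have htw_le : tw ≤ t := measureReal_mono inter_subset_left
  have hdz_le : dz ≤ d := measureReal_mono inter_subset_left
  unfold polMargin
  rw [htw', hdz', hgD' Zv, hgD' Yv, hgD'0, hIZ]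
  constructor
  · -- M₁ = t'(d I − I dz) + [t(d' I − 0·dz) − tw(d' IY − 0·dy)] + [t(d·0 − I·0) − tw(d·0 − I dy')]
    have e : t' * (d * I - I * dz) - 0 * (d * IY - I * dy) + (t * (d' * I - 0 * dz) - tw * (d' * IY - 0 * dy)) +
        (t * (d * 0 - I * 0) - tw * (d * 0 - I * dy')) = t' * I * d' + d' * (t * I - tw * IY) + tw * I * dy' := by
      rw [hd'eq]; ring
    rw [e]
    have h1 : 0 ≤ t' * I * d' := mul_nonneg (mul_nonneg (h0 _) hI0) (h0 _)
    have h2 : 0 ≤ d' * (t * I - tw * IY) := mul_nonneg (h0 _) (by nlinarith [htw_le, hIYle, h0 (A ∩ D ∩ openConn y z), hIY0])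
    have h3 : 0 ≤ tw * I * dy' := mul_nonneg (mul_nonneg (h0 _) hI0) (h0 _)
    linarith
  · -- M₂ = t'(d' I − 0·dz) − 0 + [t'(d·0 − I·0) − 0] + [t(d'·0 − 0·0) − tw(d'·0 − 0·dy')]
    have e : t' * (d' * I - 0 * dz) - 0 * (d' * IY - 0 * dy) + (t' * (d * 0 - I * 0) - 0 * (d * 0 - I * dy')) +
        (t * (d' * 0 - 0 * 0) - tw * (d' * 0 - 0 * dy')) = t' * d' * I := by ring
    rw [e]
    exact mul_nonneg (mul_nonneg (h0 _) (h0 _)) hI0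


/-- **CROSS at `u = z`, reach-pinned class II: `F` constant on `{z ∈ V(C_s)}`, given the cross-conditioning exchange (F1).**  For monotone `F`
with `F(C) = M` whenever `z = s` or a pair of `C` contains `z` (all up-events `U ⊇ {s↔z}`), and assuming
(F1) `μ(T∩W)·μ(D'∩Y) ≤ μ(T')·μ(D∩Z)` (`D' = {s ↮ X∪{z}}`, `T' = {y ↮ {s}∪X∪{z}} ∩ D'`; this is `Consts.crossExchange_F1`, an instance of
`Consts.localEv_fourEvents`, kept as a hypothesis here), both CROSS members for `X ⊂ X ∪ {z}` are nonnegative.  With `G = F − M ≤ 0` (vanishing on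
`{s↔z}`), `I = ∫_D G`, `I_Y = ∫_{D∩Y} G`: `M₂ = −I·(μ(T')μ(D∩Z) − μ(T∩W)μ(D'∩Y)) − μ(T∩W)μ(D')I_Y` and
`M₁ = −I·[μ(D∩Z)(μ(T)+μ(T')) − μ(T∩W)(μ(D∩Y)+μ(D'∩Y))] − μ(T∩W)(μ(D)+μ(D'))I_Y`, nonnegative by (F1) and `Consts.mdlx_marker_reach_le`.
[cite: VandenbergHaggstromKahn2005, Thm. 1.1 (pp. 3–5), Thm. 1.3 (p. 6), Thm. 1.4 (p. 7)] -/
theorem crossRel_reach_of_eq_on_reach (w : Sym2 V → unitInterval) (s y z : V) (X : Set V)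
    (F : Set (Sym2 V) → ℝ) (hF : Monotone F) (M : ℝ) (hFz : ∀ C : Set (Sym2 V), (z = s ∨ ∃ e ∈ C, z ∈ e) → F C = M)
    (hF1 : (prodBernoulli w).real ({ω : BondConfig V | ∀ x ∈ insert s X, ¬ (openGraph ω).Reachable y x} ∩
          {ω | ∀ x ∈ X, ¬ (openGraph ω).Reachable s x} ∩ openConn y z) *
        (prodBernoulli w).real ({ω : BondConfig V | ∀ x ∈ insert z X, ¬ (openGraph ω).Reachable s x} ∩ openConn s y) ≤
      (prodBernoulli w).real ({ω : BondConfig V | ∀ x ∈ insert s (insert z X), ¬ (openGraph ω).Reachable y x} ∩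
          {ω | ∀ x ∈ insert z X, ¬ (openGraph ω).Reachable s x}) *
        (prodBernoulli w).real ({ω : BondConfig V | ∀ x ∈ X, ¬ (openGraph ω).Reachable s x} ∩ openConn s z)) :
    0 ≤ polMargin (prodBernoulli w) s y z F (insert z X) X X + polMargin (prodBernoulli w) s y z F X (insert z X) X +
        polMargin (prodBernoulli w) s y z F X X (insert z X) ∧
      0 ≤ polMargin (prodBernoulli w) s y z F (insert z X) (insert z X) X +
          polMargin (prodBernoulli w) s y z F (insert z X) X (insert z X) +
        polMargin (prodBernoulli w) s y z F X (insert z X) (insert z X) := by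
  classical
  set μ := prodBernoulli w with hμ
  -- degenerate case `z = s`
  by_cases hzs : z = s
  · subst hzs
    have h0 : ∀ X₁ X₂ : Set V, polMargin μ z y z F (insert z X) X₁ X₂ = 0 := fun X₁ X₂ =>
      polMargin_eq_zero_of_slot0 μ z y z F _ X₁ X₂ (Or.inl (mem_insert z X))
    have h1 : ∀ X₀ X₂ : Set V, polMargin μ z y z F X₀ (insert z X) X₂ = 0 := fun X₀ X₂ =>
      polMargin_eq_zero_of_slot1 μ z y z F X₀ _ X₂ (mem_insert z X)
    have h2 : ∀ X₀ X₁ : Set V, polMargin μ z y z F X₀ X₁ (insert z X) = 0 := fun X₀ X₁ =>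
      polMargin_eq_zero_of_slot2 μ z y z F X₀ X₁ _ (mem_insert z X)
    rw [h0, h1, h2, h0, h0, h1]; norm_num
  -- shift: `G = F − M ≤ 0`, vanishing on `{s ↔ z}`
  rw [← polMargin_sub_const w s y z F M (insert z X) X X, ← polMargin_sub_const w s y z F M X (insert z X) X,
    ← polMargin_sub_const w s y z F M X X (insert z X), ← polMargin_sub_const w s y z F M (insert z X) (insert z X) X,
    ← polMargin_sub_const w s y z F M (insert z X) X (insert z X), ← polMargin_sub_const w s y z F M X (insert z X) (insert z X)]
  set G : Set (Sym2 V) → ℝ := fun C => F C - M with hG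
  have hmeas : ∀ S : Set (BondConfig V), MeasurableSet S := fun _ => MeasurableSet.of_discrete
  set D : Set (BondConfig V) := {ω | ∀ x ∈ X, ¬ (openGraph ω).Reachable s x} with hD
  set D' : Set (BondConfig V) := {ω | ∀ x ∈ insert z X, ¬ (openGraph ω).Reachable s x} with hD'
  set A : Set (BondConfig V) := {ω | ∀ x ∈ insert s X, ¬ (openGraph ω).Reachable y x} with hA
  set A' : Set (BondConfig V) := {ω | ∀ x ∈ insert s (insert z X), ¬ (openGraph ω).Reachable y x} with hA'
  set Yv : Set (BondConfig V) := openConn s y with hYv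
  set Zv : Set (BondConfig V) := openConn s z with hZv
  set g : BondConfig V → ℝ := fun ω => G (openEdgeCluster ω s) with hg
  -- `F ≤ M` everywhere (add a pair containing `z`), so `g ≤ 0`; `g = 0` on `{s ↔ z}`
  have hFle : ∀ C : Set (Sym2 V), F C ≤ M := by
    intro C
    have h1 : F C ≤ F (C ∪ {s(z, z)}) := hF subset_union_left
    have h2 : F (C ∪ {s(z, z)}) = M := hFz _ (Or.inr ⟨s(z, z), mem_union_right C rfl, Sym2.mem_mk_left z z⟩)
    linarith
  have hg0 : ∀ ω, g ω ≤ 0 := fun ω => sub_nonpos.2 (hFle _)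
  have hgZ : ∀ ω, ω ∈ Zv → g ω = 0 := by
    intro ω hω
    show F (openEdgeCluster ω s) - M = 0
    rw [hFz _ ((reachable_iff_exists_mem_openEdgeCluster ω s z).1 hω), sub_self]
  -- set facts
  have hD'eq : D' = D \ Zv := avoid_insert_eq_diff s z X
  have hD'Z : D' ∩ Zv = ∅ := by rw [hD'eq]; exact Set.sdiff_inter_self
  have hA'W : ∀ S : Set (BondConfig V), A' ∩ S ∩ openConn y z = ∅ := avoidY_insert_inter_conn_eq_empty s y z X
  -- base quantities
  set t := μ.real (A ∩ D) with ht
  set tw := μ.real (A ∩ D ∩ openConn y z) with htw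
  set t' := μ.real (A' ∩ D') with ht'
  set d := μ.real D with hd
  set d' := μ.real D' with hd'
  set dz := μ.real (D ∩ Zv) with hdz
  set dy := μ.real (D ∩ Yv) with hdy
  set dy' := μ.real (D' ∩ Yv) with hdy'
  set I := ∫ ω in D, g ω ∂μ with hI
  set IY := ∫ ω in D ∩ Yv, g ω ∂μ with hIY
  have hgi : ∀ S : Set (BondConfig V), IntegrableOn g S μ := fun S => (Integrable.of_finite (f := g)).integrableOn
  have hI0 : I ≤ 0 := setIntegral_nonpos (hmeas D) fun ω _ => hg0 ω
  have hIY0 : IY ≤ 0 := setIntegral_nonpos (hmeas _) fun ω _ => hg0 ω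
  have hIZ : ∫ ω in D ∩ Zv, g ω ∂μ = 0 := setIntegral_eq_zero_of_forall_eq_zero fun ω hω => hgZ ω hω.2
  -- the primed integrals: all the mass of `g` sits off `{s ↔ z}`
  have hID' : ∫ ω in D', g ω ∂μ = I := by
    have h := integral_inter_add_sdiff (μ := μ) (s := D) (hmeas Zv) (hgi D)
    rw [hIZ, ← hI] at h; rw [hD'eq]; linarith
  have hIYD' : ∫ ω in D' ∩ Yv, g ω ∂μ = IY := by
    have h := integral_inter_add_sdiff (μ := μ) (s := D ∩ Yv) (hmeas Zv) (hgi _)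
    have h2 : ∫ ω in D ∩ Yv ∩ Zv, g ω ∂μ = 0 := setIntegral_eq_zero_of_forall_eq_zero fun ω hω => hgZ ω hω.2
    rw [h2, ← hIY] at h
    have hD'Y : D' ∩ Yv = (D ∩ Yv) \ Zv := by rw [hD'eq, Set.inter_sdiff_right_comm]
    rw [hD'Y]; linarith
  have hIZD' : ∫ ω in D' ∩ Zv, g ω ∂μ = 0 := by rw [hD'Z, Measure.restrict_empty, integral_zero_measure]
  have hdz' : μ.real (D' ∩ Zv) = 0 := by rw [hD'Z, measureReal_empty]
  have htw' : μ.real (A' ∩ D' ∩ openConn y z) = 0 := by rw [hA'W, measureReal_empty]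
  -- the two inputs
  have key := mdlx_marker_reach_le w s y z X
  change tw * dy ≤ t * dz at key
  change tw * dy' ≤ t' * dz at hF1
  have h0 : ∀ S : Set (BondConfig V), 0 ≤ μ.real S := fun _ => measureReal_nonneg
  unfold polMargin
  rw [htw', hdz', hIZD', hIYD', hID', hIZ]
  constructor
  · -- M₁ = t'(d·0 − I dz) − 0 + [t(d'·0 − I·dz) − tw(d' IY − I dy)] + [t(d·0 − I·0) − tw(d IY − I dy')]
    have e : t' * (d * 0 - I * dz) - 0 * (d * IY - I * dy) + (t * (d' * 0 - I * dz) - tw * (d' * IY - I * dy)) +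
        (t * (d * 0 - I * 0) - tw * (d * IY - I * dy')) =
        (-I) * (dz * (t + t') - tw * (dy + dy')) + tw * (d + d') * (-IY) := by ring
    rw [e]
    have h1 : 0 ≤ (-I) * (dz * (t + t') - tw * (dy + dy')) := mul_nonneg (by linarith) (by linarith)
    have h2 : 0 ≤ tw * (d + d') * (-IY) := mul_nonneg (mul_nonneg (h0 _) (add_nonneg (h0 _) (h0 _))) (by linarith)
    linarith
  · -- M₂ = t'(d'·0 − I·dz) − 0 + [t'(d·0 − I·0) − 0] + [t(d'·0 − I·0) − tw(d' IY − I dy')]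
    have e : t' * (d' * 0 - I * dz) - 0 * (d' * IY - I * dy) + (t' * (d * 0 - I * 0) - 0 * (d * IY - I * dy')) +
        (t * (d' * 0 - I * 0) - tw * (d' * IY - I * dy')) = (-I) * (t' * dz - tw * dy') + tw * d' * (-IY) := by ring
    rw [e]
    have h1 : 0 ≤ (-I) * (t' * dz - tw * dy') := mul_nonneg (by linarith) (by linarith)
    have h2 : 0 ≤ tw * d' * (-IY) := mul_nonneg (mul_nonneg (h0 _) (h0 _)) (by linarith)
    linarith

end Consts

end Summit.CriticalPhenomena.PercolationContinuityZ3.Theorems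

end
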